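import Summits.NavierStokesRegularity.FunctionalMining.StretchingLaminateBurkholderConcaveRegions
import Mathlib.Analysis.SpecialFunctions.Sqrt
import Mathlib.Analysis.SpecialFunctions.ExpDeriv
import Mathlib.Tactic.FieldSimp
import Mathlib.Tactic.Linarith
import HarnessLib

/-!
# FunctionalMining — towards `BurkConcave` (3): first derivatives of Burkholder's pieces along a line and the SEAM identities

search for candidate a priori estimates; no regularity claim.  Cell `pub-nsfunc`, prove seat gen 7.  Third set of bricks for
the DISCHARGE of the typed hypothesis `Laminate.BurkConcave` (Burkholder 1991, LNM 1464, §8, (8.11)–(8.16)); companion of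
`…ConcaveRegions` (region-wise concavity of the pieces `D₀ … D₄` along a line, squared norms `q(t) = a + 2bt + ct²`,
`p(t) = d + 2et + ft²`, `R = √q`, `Z = √p`, `u = b + ct = ½q'`, `v = e + ft = ½p'`) and `…ConcaveGlue` (gluing concave
pieces across a seam when the right derivative does not exceed the left one, `Burk.concaveOn_Icc_glue_of_deriv`).
CONTENT: the first derivatives of the four non-constant pieces as exported `HasDerivAt` lemmas (`hasDerivAt_D0_line`,
`hasDerivAt_D1_line` on `{q, p > 0}`, `hasDerivAt_D2_line` on `{p > 0, D ≠ 0}`, `hasDerivAt_D3_line`), and the four SEAM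
identities between the derivative VALUES at a seam point, as pure real identities: the seams `R + Z = 1` (`D₀/D₁`) and
`Z = λ − 1 − R` (`D₁/D₂`) are `C¹` (the values agree), while at `Z = λ − 1 + R` (`D₂/D₃`) and `Z² = λ² − 1 + R²` (`D₃/D₄`)
the difference of the values is an explicit multiple of the crossing speed (`d/dt (Z − R)`, resp. `d/dt (p − q) = 2(v − u)`),
so the derivative drops in the direction of crossing for `λ > 2` — the concave kinks of Burkholder's `u_λ`.
HONEST SIZE: one-variable calculus and `field_simp; ring` identities; NOT here: the sphere endpoints, the degenerate seam
points (`R = 0`, tangential crossings) and the assembly of `BurkConcave` (roadmap: prove seat HANDOFF gen 7 → 8) —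
SUPERSEDED 2026-08-20T19:30Z: `BurkConcave` is discharged in the tree by `Literature.Probability.Process.burkholderU_concaveOn`
(lit seat, p233232) + `Laminate.burkConcave_holds` (p233689); the `R = 0` point inside `D₁` (referee F39.1/F40.2: the one-sided
derivatives of `2α(1−R)e^{R+Z−λ−1}` agree there, the `−c²s·e^{cs}`-type term vanishing) is handled inside that proof; these
bricks remain as an independent, unfinished route.  Nothing about Navier–Stokes.
-/

noncomputable section

namespace Summit.NavierStokesRegularity.FunctionalMining

namespace Burk

open Literature.Probability.Process Set

/-! ## First derivatives of the pieces along a line -/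

/-- `d/dt` of the `D₀` piece: `αe^{−λ}·(2(e+ft) − 2(b+ct))`. [ours; bookkeeping] -/
theorem hasDerivAt_D0_line (lam a b c d e f t : ℝ) :
    HasDerivAt (fun s => burkholderAlpha * (1 + (d + 2 * e * s + f * s ^ 2) - (a + 2 * b * s + c * s ^ 2))
      * Real.exp (-lam)) (burkholderAlpha * (2 * (e + f * t) - 2 * (b + c * t)) * Real.exp (-lam)) t := by
  have h1 : HasDerivAt (fun s => 1 + (d + 2 * e * s + f * s ^ 2) - (a + 2 * b * s + c * s ^ 2))
      (2 * (e + f * t) - 2 * (b + c * t)) t :=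
    ((hasDerivAt_quad d e f t).const_add 1).sub (hasDerivAt_quad a b c t)
  have h2 : HasDerivAt (fun s => burkholderAlpha * (1 + (d + 2 * e * s + f * s ^ 2) - (a + 2 * b * s + c * s ^ 2)))
      (burkholderAlpha * (2 * (e + f * t) - 2 * (b + c * t))) t := h1.const_mul _
  exact h2.mul_const _

/-- `d/dt` of the `D₃` piece: `(2(e+ft) − 2(b+ct))/(4(λ−1))`. [ours; bookkeeping] -/
theorem hasDerivAt_D3_line (lam a b c d e f t : ℝ) :
    HasDerivAt (fun s => 1 - (lam ^ 2 - 1 - (d + 2 * e * s + f * s ^ 2) + (a + 2 * b * s + c * s ^ 2))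
      / (4 * (lam - 1))) ((2 * (e + f * t) - 2 * (b + c * t)) / (4 * (lam - 1))) t := by
  have h := (((hasDerivAt_quad d e f t).const_sub (lam ^ 2 - 1)).add (hasDerivAt_quad a b c t)).div_const
    (4 * (lam - 1))
  have h2 := h.const_sub 1
  refine h2.congr_deriv ?_
  ring

/-- `d/dt` of the `D₁` piece: `2αe^{R+Z−λ−1}·((1−R)(e+ft)/Z − (b+ct))`, `R = √q`, `Z = √p`, where `q, p > 0`.
[ours; bookkeeping] -/
theorem hasDerivAt_D1_line (lam a b c d e f t : ℝ) (hq : 0 < a + 2 * b * t + c * t ^ 2)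
    (hp : 0 < d + 2 * e * t + f * t ^ 2) :
    HasDerivAt (fun s => 2 * burkholderAlpha * (1 - Real.sqrt (a + 2 * b * s + c * s ^ 2))
      * Real.exp (Real.sqrt (a + 2 * b * s + c * s ^ 2) + Real.sqrt (d + 2 * e * s + f * s ^ 2) - lam - 1))
      (2 * burkholderAlpha * Real.exp (Real.sqrt (a + 2 * b * t + c * t ^ 2)
          + Real.sqrt (d + 2 * e * t + f * t ^ 2) - lam - 1)
        * ((1 - Real.sqrt (a + 2 * b * t + c * t ^ 2)) * (e + f * t) / Real.sqrt (d + 2 * e * t + f * t ^ 2)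
          - (b + c * t))) t := by
  obtain ⟨R, hR⟩ : ∃ R : ℝ → ℝ, R = fun s => Real.sqrt (a + 2 * b * s + c * s ^ 2) := ⟨_, rfl⟩
  obtain ⟨Z, hZ⟩ : ∃ Z : ℝ → ℝ, Z = fun s => Real.sqrt (d + 2 * e * s + f * s ^ 2) := ⟨_, rfl⟩
  have hRd : HasDerivAt R ((b + c * t) / R t) t := by rw [hR]; exact hasDerivAt_sqrt_quad a b c t hq
  have hZd : HasDerivAt Z ((e + f * t) / Z t) t := by rw [hZ]; exact hasDerivAt_sqrt_quad d e f t hp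
  have hR0 : R t ≠ 0 := by rw [hR]; exact (Real.sqrt_pos.2 hq).ne'
  have hZ0 : Z t ≠ 0 := by rw [hZ]; exact (Real.sqrt_pos.2 hp).ne'
  have hE : HasDerivAt (fun s => R s + Z s - lam - 1) ((b + c * t) / R t + (e + f * t) / Z t) t :=
    ((hRd.add hZd).sub_const lam).sub_const 1
  have hexp := hE.exp
  have hA : HasDerivAt (fun s => 2 * burkholderAlpha * (1 - R s)) (2 * burkholderAlpha * (0 - (b + c * t) / R t)) t :=
    ((hasDerivAt_const t (1 : ℝ)).sub hRd).const_mul _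
  have h : HasDerivAt (fun s => 2 * burkholderAlpha * (1 - R s) * Real.exp (R s + Z s - lam - 1))
      (2 * burkholderAlpha * (0 - (b + c * t) / R t) * Real.exp (R t + Z t - lam - 1)
        + 2 * burkholderAlpha * (1 - R t) * (Real.exp (R t + Z t - lam - 1)
          * ((b + c * t) / R t + (e + f * t) / Z t))) t := hA.mul hexp
  have goal : HasDerivAt (fun s => 2 * burkholderAlpha * (1 - R s) * Real.exp (R s + Z s - lam - 1))
      (2 * burkholderAlpha * Real.exp (R t + Z t - lam - 1) * ((1 - R t) * (e + f * t) / Z t - (b + c * t))) t := by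
    refine h.congr_deriv ?_
    field_simp
    ring
  subst hR hZ
  exact goal

/-- `d/dt` of the `D₂` piece `(1−q)/D`, `D = (λ−Z)² + 1 − q`, `Z = √p`:
`(−2u·D + (1−q)(2(λ−Z)v/Z + 2u))/D²` (`u = b+ct`, `v = e+ft`), where `p > 0` and `D ≠ 0`. [ours; bookkeeping] -/
theorem hasDerivAt_D2_line (lam a b c d e f t : ℝ) (hp : 0 < d + 2 * e * t + f * t ^ 2)
    (hD : (lam - Real.sqrt (d + 2 * e * t + f * t ^ 2)) ^ 2 + 1 - (a + 2 * b * t + c * t ^ 2) ≠ 0) :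
    HasDerivAt (fun s => (1 - (a + 2 * b * s + c * s ^ 2))
      / ((lam - Real.sqrt (d + 2 * e * s + f * s ^ 2)) ^ 2 + 1 - (a + 2 * b * s + c * s ^ 2)))
      ((-2 * (b + c * t) * ((lam - Real.sqrt (d + 2 * e * t + f * t ^ 2)) ^ 2 + 1 - (a + 2 * b * t + c * t ^ 2))
        + (1 - (a + 2 * b * t + c * t ^ 2)) * (2 * (lam - Real.sqrt (d + 2 * e * t + f * t ^ 2))
          * (e + f * t) / Real.sqrt (d + 2 * e * t + f * t ^ 2) + 2 * (b + c * t)))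
        / ((lam - Real.sqrt (d + 2 * e * t + f * t ^ 2)) ^ 2 + 1 - (a + 2 * b * t + c * t ^ 2)) ^ 2) t := by
  obtain ⟨q, hq⟩ : ∃ q : ℝ → ℝ, q = fun s => a + 2 * b * s + c * s ^ 2 := ⟨_, rfl⟩
  obtain ⟨Z, hZ⟩ : ∃ Z : ℝ → ℝ, Z = fun s => Real.sqrt (d + 2 * e * s + f * s ^ 2) := ⟨_, rfl⟩
  have hqd : HasDerivAt q (2 * (b + c * t)) t := by rw [hq]; exact hasDerivAt_quad a b c t
  have hZd : HasDerivAt Z ((e + f * t) / Z t) t := by rw [hZ]; exact hasDerivAt_sqrt_quad d e f t hp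
  have hZ0 : Z t ≠ 0 := by rw [hZ]; exact (Real.sqrt_pos.2 hp).ne'
  have hD' : (lam - Z t) ^ 2 + 1 - q t ≠ 0 := by rw [hZ, hq]; exact hD
  have hN : HasDerivAt (fun s => 1 - q s) (0 - 2 * (b + c * t)) t := (hasDerivAt_const t (1:ℝ)).sub hqd
  have hLZ : HasDerivAt (fun s => lam - Z s) (0 - (e + f * t) / Z t) t := (hasDerivAt_const t lam).sub hZd
  have hDd : HasDerivAt (fun s => (lam - Z s) ^ 2 + 1 - q s)
      (2 * (lam - Z t) * (0 - (e + f * t) / Z t) + 0 - 2 * (b + c * t)) t := by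
    have h2 := hLZ.pow 2
    have h3 : HasDerivAt (fun s => (lam - Z s) ^ 2 + 1 - q s)
        (((2 : ℕ) : ℝ) * (lam - Z t) ^ (2 - 1) * (0 - (e + f * t) / Z t) + 0 - 2 * (b + c * t)) t :=
      (h2.add (hasDerivAt_const t (1:ℝ))).sub hqd
    refine h3.congr_deriv ?_
    simp only [Nat.cast_ofNat]
    ring
  have h : HasDerivAt (fun s => (1 - q s) / ((lam - Z s) ^ 2 + 1 - q s))
      (((0 - 2 * (b + c * t)) * ((lam - Z t) ^ 2 + 1 - q t)
        - (1 - q t) * (2 * (lam - Z t) * (0 - (e + f * t) / Z t) + 0 - 2 * (b + c * t)))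
        / ((lam - Z t) ^ 2 + 1 - q t) ^ 2) t := hN.div hDd hD'
  have goal : HasDerivAt (fun s => (1 - q s) / ((lam - Z s) ^ 2 + 1 - q s))
      ((-2 * (b + c * t) * ((lam - Z t) ^ 2 + 1 - q t)
        + (1 - q t) * (2 * (lam - Z t) * (e + f * t) / Z t + 2 * (b + c * t)))
        / ((lam - Z t) ^ 2 + 1 - q t) ^ 2) t := by
    refine h.congr_deriv ?_
    field_simp
    ring
  subst hq hZ
  exact goal

/-! ## Seam identities for the one-sided derivatives (values at a seam point; `R = √q`, `Z = √p`, `u = b+ct`, `v = e+ft`) -/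

/-- Seam `D₀/D₁` (`R + Z = 1`): the two derivative values AGREE (`C¹` seam). [ours; elementary] -/
theorem seam_D0_D1 (lam R Z u v : ℝ) (hZ : Z ≠ 0) (hseam : R + Z = 1) :
    burkholderAlpha * (2 * v - 2 * u) * Real.exp (-lam)
      = 2 * burkholderAlpha * Real.exp (R + Z - lam - 1) * ((1 - R) * v / Z - u) := by
  have h1 : 1 - R = Z := by linarith
  rw [h1, show R + Z - lam - 1 = -lam by linarith]
  field_simp

/-- Seam `D₁/D₂` (`Z = λ − 1 − R`, `R ≠ 0`; there `D = (λ−Z)²+1−R² = 2(1+R)` and `e^{R+Z−λ−1} = e^{−2}`, `2αe^{−2} = ½`):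
the two derivative values AGREE (`C¹` seam). [ours; elementary] -/
theorem seam_D1_D2 (lam R Z u v : ℝ) (hZ : Z ≠ 0) (hR : -1 < R) (hseam : Z = lam - 1 - R) :
    2 * burkholderAlpha * Real.exp (R + Z - lam - 1) * ((1 - R) * v / Z - u)
      = (-2 * u * ((lam - Z) ^ 2 + 1 - R ^ 2) + (1 - R ^ 2) * (2 * (lam - Z) * v / Z + 2 * u))
        / ((lam - Z) ^ 2 + 1 - R ^ 2) ^ 2 := by
  have hD : (lam - Z) ^ 2 + 1 - R ^ 2 = 2 * (1 + R) := by rw [hseam]; ring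
  have h2 : Real.exp (R + Z - lam - 1) = Real.exp (-2) := by rw [hseam]; ring_nf
  have hα : 2 * burkholderAlpha * Real.exp (-2) = 1 / 2 := by
    unfold burkholderAlpha; rw [Real.exp_neg]; have := Real.exp_pos 2; field_simp; norm_num
  rw [h2, hD, show lam - Z = 1 + R by linarith]
  have h1R : (1 + R) ≠ 0 := by linarith
  rw [show 2 * burkholderAlpha * Real.exp (-2) * ((1 - R) * v / Z - u) = (1 / 2) * ((1 - R) * v / Z - u) by
    rw [← hα]]
  field_simp
  ring

/-- Seam `D₂/D₃` (`Z = λ − 1 + R`, `R < 1`; there `D = (λ−Z)²+1−R² = 2(1−R)`): the difference of the two derivative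
values is `D₂' − D₃' = (λ − 2)·(v·R − u·Z)/(2(λ−1)Z)`; for `λ > 2`, `R, Z > 0` its sign is that of
`v/Z − u/R = d/dt (Z − R)`, i.e. the derivative DROPS in the direction in which the line crosses the seam `Z − R = λ − 1`
(the concave kink of Burkholder 1991, §8). [ours; elementary] -/
theorem seam_D2_D3 (lam R Z u v : ℝ) (hZ : Z ≠ 0) (hR1 : R < 1) (hlam : lam ≠ 1) (hseam : Z = lam - 1 + R) :
    (-2 * u * ((lam - Z) ^ 2 + 1 - R ^ 2) + (1 - R ^ 2) * (2 * (lam - Z) * v / Z + 2 * u)) / ((lam - Z) ^ 2 + 1 - R ^ 2) ^ 2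
      - (2 * v - 2 * u) / (4 * (lam - 1)) = (lam - 2) * (v * R - u * Z) / (2 * (lam - 1) * Z) := by
  have hD : (lam - Z) ^ 2 + 1 - R ^ 2 = 2 * (1 - R) := by rw [hseam]; ring
  rw [hD, show lam - Z = 1 - R by linarith]
  have h1R : (1 - R) ≠ 0 := by linarith
  have hl1 : lam - 1 ≠ 0 := sub_ne_zero.2 hlam
  field_simp
  rw [hseam]
  ring

/-- Seam `D₃/D₄` (`Z² = λ² − 1 + R²`): the `D₃`-derivative is `(v − u)/(2(λ−1))` and the `D₄`-derivative is `0`; the drop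
condition reads `sign(v − u) = ` direction of crossing of `p − q − (λ²−1)` (derivative `2(v−u)`). Recorded as the identity
`(2v − 2u)/(4(λ−1)) − 0 = (v − u)/(2(λ−1))`. [ours; bookkeeping] -/
theorem seam_D3_D4 (lam u v : ℝ) (hlam : lam ≠ 1) :
    (2 * v - 2 * u) / (4 * (lam - 1)) - 0 = (v - u) / (2 * (lam - 1)) := by
  have hl1 : lam - 1 ≠ 0 := sub_ne_zero.2 hlam
  field_simp
  ring

end Burk

end Summit.NavierStokesRegularity.FunctionalMining

end
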